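import Mathlib.Analysis.SpecialFunctions.Gaussian.PoissonSummation
import Mathlib.Analysis.SpecialFunctions.Pow.Real
import Mathlib.Analysis.SpecialFunctions.Exp
import Mathlib.Analysis.Real.Pi.Bounds
import Mathlib.Analysis.SpecificLimits.Basic
import Mathlib.Topology.Algebra.InfiniteSum.NatInt
import HarnessLib

/-!
# The Gaussian lattice sum `∑_{n ∈ ℤ} e^{-c n²}` and the heat trace on a circle

Elementary, fully proved estimates for the one-dimensional theta sum
`G(c) = ∑_{n ∈ ℤ} e^{-c n²}` (`c > 0`) and for the heat trace of the circle `ℝ/Lℤ`,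
`θ_L(t) = tr e^{tΔ} = ∑_{n ∈ ℤ} e^{-t(2πn/L)²} = G(4π²t/L²)`:

* `gaussLatticeSum_poisson`: Jacobi's imaginary transformation `G(c) = √(π/c) · G(π²/c)`
  (Mathlib's Poisson summation `Real.tsum_exp_neg_mul_int_sq`);
* `one_le_gaussLatticeSum`, `gaussLatticeSum_le`: `1 ≤ G(c) ≤ 1 + 2/(e^c - 1)` (geometric
  comparison `e^{-cn²} ≤ e^{-cn}`), and `G(c) → 1` as `c → ∞`;
* `circleHeatTrace_eq_mul`: `θ_L(t) = (L/√(4πt)) · G(L²/4t)`, whence the two-sided bounds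
  `L/√(4πt) ≤ θ_L(t) ≤ (L/√(4πt))(1 + 2/(e^{L²/4t} - 1))`, `1 ≤ θ_L(t) ≤ 1 + 2/(e^{4π²t/L²} - 1)`,
  the Weyl-type limit `θ_L(t)/L → 1/√(4πt)` (`L → ∞`), and the uniform bound
  `0 ≤ θ_L(t)³ - 1 ≤ L³/(t√t)` (`circleHeatTrace_cube_sub_one_le`) used as a Tannery dominant for
  the three-dimensional torus `(ℝ/Lℤ)³`, whose heat trace is `θ_L(t)³`.

All statements are for `L > 0`, `t > 0`. Not here: higher-dimensional lattices other than via
the cube, sharp constants, asymptotic expansions. [folklore]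
-/

noncomputable section

open Real Filter
open scoped Topology BigOperators

namespace Literature.Analysis.SpecialFunctions

/-- The Gaussian lattice sum `G(c) = ∑_{n ∈ ℤ} e^{-c n²}`. [folklore] -/
def gaussLatticeSum (c : ℝ) : ℝ := ∑' n : ℤ, rexp (-(c * (n : ℝ) ^ 2))

/-- The heat trace of the circle of circumference `L` at time `t`:
`θ_L(t) = ∑_{n ∈ ℤ} e^{-t (2πn/L)²}`. [folklore] -/
def circleHeatTrace (L t : ℝ) : ℝ := ∑' n : ℤ, rexp (-(t * (2 * π * n / L) ^ 2))

/-! ### The tails `∑_{n ≥ 1} e^{-c n²}` -/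

/-- Summability of the Gaussian tail `∑_{n ≥ 0} e^{-c (n+1)²}` for `c > 0`. [folklore] -/
theorem summable_gauss_tail {c : ℝ} (hc : 0 < c) :
    Summable fun n : ℕ => rexp (-(c * ((n : ℝ) + 1) ^ 2)) := by
  have h := Real.summable_exp_nat_mul_of_ge (neg_lt_zero.mpr hc)
    (f := fun i : ℕ => ((i : ℝ) + 1) ^ 2) (fun i => by nlinarith [(Nat.cast_nonneg i : (0 : ℝ) ≤ i)])
  refine h.congr fun n => ?_
  congr 1
  ring

/-- Geometric comparison: `∑_{n ≥ 0} e^{-c(n+1)²} ≤ 1/(e^c - 1)` for `c > 0`. [folklore] -/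
theorem gauss_tail_le {c : ℝ} (hc : 0 < c) :
    ∑' n : ℕ, rexp (-(c * ((n : ℝ) + 1) ^ 2)) ≤ 1 / (rexp c - 1) := by
  have hq : rexp (-c) < 1 := Real.exp_lt_one_iff.mpr (neg_lt_zero.mpr hc)
  have hq0 : 0 ≤ rexp (-c) := (exp_pos _).le
  have hgeom : HasSum (fun n : ℕ => rexp (-c) ^ (n + 1)) (rexp (-c) / (1 - rexp (-c))) := by
    have := (hasSum_geometric_of_lt_one hq0 hq).mul_left (rexp (-c))
    simpa [pow_succ, mul_comm, div_eq_mul_inv] using this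
  have hle : ∀ n : ℕ, rexp (-(c * ((n : ℝ) + 1) ^ 2)) ≤ rexp (-c) ^ (n + 1) := by
    intro n
    rw [← Real.exp_nat_mul]
    apply Real.exp_le_exp.mpr
    push_cast
    have hn : (0 : ℝ) ≤ n := Nat.cast_nonneg n
    nlinarith [mul_nonneg hc.le (mul_nonneg hn (by linarith : (0 : ℝ) ≤ n + 1))]
  calc ∑' n : ℕ, rexp (-(c * ((n : ℝ) + 1) ^ 2)) ≤ ∑' n : ℕ, rexp (-c) ^ (n + 1) :=
        (summable_gauss_tail hc).tsum_le_tsum hle hgeom.summable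
    _ = rexp (-c) / (1 - rexp (-c)) := hgeom.tsum_eq
    _ = 1 / (rexp c - 1) := by
        have h1 : rexp c ≠ 0 := (exp_pos c).ne'
        rw [Real.exp_neg]
        field_simp

/-- Splitting off `n = 0` and folding `n ↦ -n`: `G(c) = 1 + 2 ∑_{n ≥ 0} e^{-c(n+1)²}`. [folklore] -/
theorem gaussLatticeSum_eq_one_add {c : ℝ} (hc : 0 < c) :
    gaussLatticeSum c = 1 + 2 * ∑' n : ℕ, rexp (-(c * ((n : ℝ) + 1) ^ 2)) := by
  set f : ℤ → ℝ := fun n => rexp (-(c * (n : ℝ) ^ 2)) with hf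
  have h1 : ∀ n : ℕ, f ((n : ℤ) + 1) = rexp (-(c * ((n : ℝ) + 1) ^ 2)) := fun n => by
    simp only [hf]
    push_cast
    ring_nf
  have h2 : ∀ n : ℕ, f (-((n : ℤ) + 1)) = rexp (-(c * ((n : ℝ) + 1) ^ 2)) := fun n => by
    simp only [hf]
    push_cast
    ring_nf
  have hs1 : Summable fun n : ℕ => f ((n : ℤ) + 1) :=
    (summable_gauss_tail hc).congr fun n => (h1 n).symm
  have hs2 : Summable fun n : ℕ => f (-((n : ℤ) + 1)) :=
    (summable_gauss_tail hc).congr fun n => (h2 n).symm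
  have hsplit := tsum_of_add_one_of_neg_add_one (f := f) hs1 hs2
  have h0 : f 0 = 1 := by simp [hf]
  unfold gaussLatticeSum
  rw [show (fun n : ℤ => rexp (-(c * (n : ℝ) ^ 2))) = f from rfl, hsplit, h0, tsum_congr h1,
    tsum_congr h2]
  ring

/-- `G(c) ≥ 1` (the `n = 0` term). [folklore] -/
theorem one_le_gaussLatticeSum {c : ℝ} (hc : 0 < c) : 1 ≤ gaussLatticeSum c := by
  rw [gaussLatticeSum_eq_one_add hc]
  have : 0 ≤ ∑' n : ℕ, rexp (-(c * ((n : ℝ) + 1) ^ 2)) := tsum_nonneg fun n => (exp_pos _).le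
  linarith

/-- `G(c) ≤ 1 + 2/(e^c - 1)` for `c > 0`. [folklore] -/
theorem gaussLatticeSum_le {c : ℝ} (hc : 0 < c) : gaussLatticeSum c ≤ 1 + 2 / (rexp c - 1) := by
  rw [gaussLatticeSum_eq_one_add hc]
  have h := gauss_tail_le hc
  have : 2 * ∑' n : ℕ, rexp (-(c * ((n : ℝ) + 1) ^ 2)) ≤ 2 * (1 / (rexp c - 1)) := by linarith
  calc 1 + 2 * ∑' n : ℕ, rexp (-(c * ((n : ℝ) + 1) ^ 2)) ≤ 1 + 2 * (1 / (rexp c - 1)) := by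
        linarith
    _ = 1 + 2 / (rexp c - 1) := by ring

/-- `G(c) > 0`. [folklore] -/
theorem gaussLatticeSum_pos {c : ℝ} (hc : 0 < c) : 0 < gaussLatticeSum c :=
  lt_of_lt_of_le one_pos (one_le_gaussLatticeSum hc)

/-- `G(c) → 1` as `c → ∞`. [folklore] -/
theorem tendsto_gaussLatticeSum_atTop : Tendsto gaussLatticeSum atTop (𝓝 1) := by
  have hexp : Tendsto (fun c => rexp c - 1) atTop atTop :=
    tendsto_atTop_add_const_right _ (-1) Real.tendsto_exp_atTop
  have h2 : Tendsto (fun c => 1 + 2 / (rexp c - 1)) atTop (𝓝 1) := by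
    simpa using tendsto_const_nhds.add (tendsto_const_nhds.div_atTop hexp)
  refine tendsto_of_tendsto_of_tendsto_of_le_of_le' tendsto_const_nhds h2 ?_ ?_
  · filter_upwards [eventually_gt_atTop 0] with c hc using one_le_gaussLatticeSum hc
  · filter_upwards [eventually_gt_atTop 0] with c hc using gaussLatticeSum_le hc

/-- **Jacobi's imaginary transformation** (Poisson summation):
`G(c) = √(π/c) · G(π²/c)` for `c > 0`. [folklore] -/
theorem gaussLatticeSum_poisson {c : ℝ} (hc : 0 < c) :
    gaussLatticeSum c = Real.sqrt (π / c) * gaussLatticeSum (π ^ 2 / c) := by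
  unfold gaussLatticeSum
  have hπ : (π : ℝ) ≠ 0 := Real.pi_pos.ne'
  have h := Real.tsum_exp_neg_mul_int_sq (a := c / π) (by positivity)
  have e1 : ∀ n : ℤ, -π * (c / π) * (n : ℝ) ^ 2 = -(c * (n : ℝ) ^ 2) := fun n => by
    field_simp
  have e2 : ∀ n : ℤ, -π / (c / π) * (n : ℝ) ^ 2 = -(π ^ 2 / c * (n : ℝ) ^ 2) := fun n => by
    rw [div_div_eq_mul_div]
    field_simp
  simp only [e1, e2] at h
  rw [h]
  congr 1
  rw [← Real.sqrt_eq_rpow, one_div, ← Real.sqrt_inv, inv_div]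

/-! ### The circle heat trace -/

/-- `θ_L(t) = G(4π²t/L²)`. [folklore] -/
theorem circleHeatTrace_eq_gaussLatticeSum (L t : ℝ) :
    circleHeatTrace L t = gaussLatticeSum (4 * π ^ 2 * t / L ^ 2) := by
  unfold circleHeatTrace gaussLatticeSum
  refine tsum_congr fun n => ?_
  congr 1
  ring

/-- **Poisson form of the heat trace**: `θ_L(t) = (L/√(4πt)) · ∑_{m ∈ ℤ} e^{-m²L²/4t}`.
[folklore] -/
theorem circleHeatTrace_eq_mul {L t : ℝ} (hL : 0 < L) (ht : 0 < t) :
    circleHeatTrace L t = L / Real.sqrt (4 * π * t) * gaussLatticeSum (L ^ 2 / (4 * t)) := by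
  have hπ : (0 : ℝ) < π := Real.pi_pos
  rw [circleHeatTrace_eq_gaussLatticeSum, gaussLatticeSum_poisson (by positivity)]
  congr 1
  · rw [show π / (4 * π ^ 2 * t / L ^ 2) = L ^ 2 / (4 * π * t) by field_simp,
      Real.sqrt_div (sq_nonneg L), Real.sqrt_sq hL.le]
  · congr 1
    field_simp

/-- `θ_L(t) ≥ 1` (the zero mode). [folklore] -/
theorem one_le_circleHeatTrace {L t : ℝ} (hL : 0 < L) (ht : 0 < t) : 1 ≤ circleHeatTrace L t := by
  rw [circleHeatTrace_eq_gaussLatticeSum]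
  exact one_le_gaussLatticeSum (by positivity)

/-- `θ_L(t) > 0`. [folklore] -/
theorem circleHeatTrace_pos {L t : ℝ} (hL : 0 < L) (ht : 0 < t) : 0 < circleHeatTrace L t :=
  lt_of_lt_of_le one_pos (one_le_circleHeatTrace hL ht)

/-- Lower Weyl bound `θ_L(t) ≥ L/√(4πt)`. [folklore] -/
theorem div_sqrt_le_circleHeatTrace {L t : ℝ} (hL : 0 < L) (ht : 0 < t) :
    L / Real.sqrt (4 * π * t) ≤ circleHeatTrace L t := by
  rw [circleHeatTrace_eq_mul hL ht]
  exact le_mul_of_one_le_right (by positivity) (one_le_gaussLatticeSum (by positivity))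

/-- Upper Weyl bound `θ_L(t) ≤ (L/√(4πt))(1 + 2/(e^{L²/4t} - 1))`. [folklore] -/
theorem circleHeatTrace_le_div_sqrt_mul {L t : ℝ} (hL : 0 < L) (ht : 0 < t) :
    circleHeatTrace L t ≤ L / Real.sqrt (4 * π * t) * (1 + 2 / (rexp (L ^ 2 / (4 * t)) - 1)) := by
  rw [circleHeatTrace_eq_mul hL ht]
  exact mul_le_mul_of_nonneg_left (gaussLatticeSum_le (by positivity)) (by positivity)

/-- Small-circle bound `θ_L(t) ≤ 1 + 2/(e^{4π²t/L²} - 1)`. [folklore] -/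
theorem circleHeatTrace_le_one_add {L t : ℝ} (hL : 0 < L) (ht : 0 < t) :
    circleHeatTrace L t ≤ 1 + 2 / (rexp (4 * π ^ 2 * t / L ^ 2) - 1) := by
  rw [circleHeatTrace_eq_gaussLatticeSum]
  exact gaussLatticeSum_le (by positivity)

/-- **Weyl asymptotics**: `θ_L(t)/L → 1/√(4πt)` as `L → ∞` (`t > 0` fixed). [folklore] -/
theorem tendsto_circleHeatTrace_div {t : ℝ} (ht : 0 < t) :
    Tendsto (fun L => circleHeatTrace L t / L) atTop (𝓝 (1 / Real.sqrt (4 * π * t))) := by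
  have h1 : Tendsto (fun L : ℝ => L ^ 2 / (4 * t)) atTop atTop :=
    (tendsto_pow_atTop two_ne_zero).atTop_div_const (by positivity)
  have h2 := (tendsto_gaussLatticeSum_atTop.comp h1).const_mul (1 / Real.sqrt (4 * π * t))
  rw [mul_one] at h2
  refine h2.congr' ?_
  filter_upwards [eventually_gt_atTop 0] with L hL
  rw [circleHeatTrace_eq_mul hL ht]
  simp only [Function.comp_apply]
  field_simp

/-- The cube (the torus `(ℝ/Lℤ)³`): `(θ_L(t)³ - 1)/L³ → (4πt)^{-3/2}` as `L → ∞`. [folklore] -/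
theorem tendsto_circleHeatTrace_cube_sub_one_div {t : ℝ} (ht : 0 < t) :
    Tendsto (fun L => (circleHeatTrace L t ^ 3 - 1) / L ^ 3) atTop
      (𝓝 ((1 / Real.sqrt (4 * π * t)) ^ 3)) := by
  have h1 := (tendsto_circleHeatTrace_div ht).pow 3
  have h2 : Tendsto (fun L : ℝ => (L ^ 3)⁻¹) atTop (𝓝 0) :=
    (tendsto_pow_atTop three_ne_zero).inv_tendsto_atTop
  have h3 := h1.sub h2
  rw [sub_zero] at h3
  refine h3.congr' ?_
  filter_upwards [eventually_gt_atTop 0] with L hL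
  rw [div_pow, sub_div, inv_eq_one_div]

/-- Arithmetic: `(1 + u)³ - 1 ≤ 4u` for `0 ≤ u ≤ 4/81`. [folklore] -/
theorem cube_one_add_sub_one_le {u : ℝ} (hu0 : 0 ≤ u) (hu1 : u ≤ 4 / 81) :
    (1 + u) ^ 3 - 1 ≤ 4 * u := by
  have hu2 : u * u ≤ 4 / 81 * u := by nlinarith
  have hu3 : u * u * u ≤ 4 / 81 * u * (4 / 81) := mul_le_mul hu2 hu1 hu0 (by positivity)
  nlinarith

/-- Arithmetic: `a² ≤ a√a` for `0 ≤ a ≤ 1`. [folklore] -/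
theorem sq_le_mul_sqrt {a : ℝ} (ha0 : 0 ≤ a) (ha1 : a ≤ 1) : a ^ 2 ≤ a * Real.sqrt a := by
  have hasq : a ≤ Real.sqrt a := Real.le_sqrt_of_sq_le (by nlinarith)
  nlinarith

/-- `G(a) ≤ 3` for `a ≥ 1` (as `e^a - 1 ≥ a ≥ 1`). [folklore] -/
theorem gaussLatticeSum_le_three {a : ℝ} (ha : 1 ≤ a) : gaussLatticeSum a ≤ 3 := by
  have h := gaussLatticeSum_le (lt_of_lt_of_le one_pos ha)
  have hexp : a ≤ rexp a - 1 := by linarith [Real.add_one_le_exp a]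
  have hfrac : 2 / (rexp a - 1) ≤ 2 := by
    rw [div_le_iff₀ (by linarith)]
    nlinarith
  linarith

/-- `(√π)³ ≥ 27/8`, i.e. `√π ≥ 3/2`. [folklore] -/
theorem sqrt_pi_cube_ge : (27 : ℝ) / 8 ≤ Real.sqrt π ^ 3 := by
  have h : (3 : ℝ) / 2 ≤ Real.sqrt π :=
    Real.le_sqrt_of_sq_le (by nlinarith [Real.pi_gt_three])
  have := pow_le_pow_left₀ (by norm_num) h 3
  norm_num at this
  linarith

/-- **Uniform cube bound** (Tannery dominant): `θ_L(t)³ - 1 ≤ L³/(t√t)` for all `L, t > 0`.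
For `L² ≥ 4t` this is the Weyl upper bound cubed (`θ ≤ 3√a/√π`, `a = L²/4t`, and
`(√π)³ ≥ 27/8`); for `L² < 4t` the small-circle bound gives `θ³ - 1 ≤ 4u ≤ 16/c²` with
`c = 4π²t/L² = π²/a ≥ 9`. [folklore] -/
theorem circleHeatTrace_cube_sub_one_le {L t : ℝ} (hL : 0 < L) (ht : 0 < t) :
    circleHeatTrace L t ^ 3 - 1 ≤ L ^ 3 / (t * Real.sqrt t) := by
  have hπ3 : (3 : ℝ) ≤ π := Real.pi_gt_three.le
  have hπsq : (9 : ℝ) ≤ π ^ 2 := by nlinarith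
  have hst : 0 < Real.sqrt t := Real.sqrt_pos.mpr ht
  have hsqt : Real.sqrt t ^ 2 = t := Real.sq_sqrt ht.le
  have hθ1 : 1 ≤ circleHeatTrace L t := one_le_circleHeatTrace hL ht
  have hθ0 : 0 ≤ circleHeatTrace L t := zero_le_one.trans hθ1
  -- the parameter `a = L²/4t`, with `√a = L/(2√t)` and `L³/(t√t) = 8 a √a`
  set a : ℝ := L ^ 2 / (4 * t) with ha
  have ha0 : 0 < a := by positivity
  have hsa : Real.sqrt a = L / (2 * Real.sqrt t) := by
    have : a = (L / (2 * Real.sqrt t)) ^ 2 := by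
      rw [ha, div_pow, mul_pow, hsqt]; ring
    rw [this, Real.sqrt_sq (by positivity)]
  have hX : 0 ≤ a * Real.sqrt a := by positivity
  have hkey : L ^ 3 / (t * Real.sqrt t) = 8 * (a * Real.sqrt a) := by
    rw [hsa, ha]
    field_simp
    ring
  rw [hkey]
  rcases le_or_gt 1 a with h1a | ha1
  · -- large circle: `θ ≤ 3 √a/√π`, cube it
    have hsπ : (0 : ℝ) < Real.sqrt π := Real.sqrt_pos.mpr Real.pi_pos
    have hL4 : L / Real.sqrt (4 * π * t) = Real.sqrt a / Real.sqrt π := by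
      rw [hsa, show (4 : ℝ) * π * t = (2 * Real.sqrt t) ^ 2 * π by rw [mul_pow, hsqt]; ring,
        Real.sqrt_mul (by positivity), Real.sqrt_sq (by positivity)]
      field_simp
    have hθ3 : circleHeatTrace L t ≤ 3 * Real.sqrt a / Real.sqrt π := by
      rw [circleHeatTrace_eq_mul hL ht, hL4, ← ha]
      calc Real.sqrt a / Real.sqrt π * gaussLatticeSum a ≤ Real.sqrt a / Real.sqrt π * 3 := by
            gcongr
            exact gaussLatticeSum_le_three h1a
        _ = 3 * Real.sqrt a / Real.sqrt π := by ring
    have hcube : circleHeatTrace L t ^ 3 ≤ (3 * Real.sqrt a / Real.sqrt π) ^ 3 :=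
      pow_le_pow_left₀ hθ0 hθ3 3
    have hsa3 : Real.sqrt a ^ 3 = a * Real.sqrt a := by rw [pow_succ, Real.sq_sqrt ha0.le]
    have hbound : (3 * Real.sqrt a / Real.sqrt π) ^ 3 ≤ 8 * (a * Real.sqrt a) := by
      rw [div_pow, div_le_iff₀ (by positivity), mul_pow, hsa3]
      nlinarith [mul_le_mul_of_nonneg_left sqrt_pi_cube_ge hX]
    linarith
  · -- small circle: `θ ≤ 1 + u`, `u = 2/(e^c - 1) ≤ 4/c²`, `c = π²/a ≥ 9`
    set c : ℝ := 4 * π ^ 2 * t / L ^ 2 with hc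
    have hca : c = π ^ 2 / a := by rw [hc, ha]; field_simp
    have hc9 : 9 ≤ c := by
      rw [hca, le_div_iff₀ ha0]
      have := mul_lt_mul_of_pos_left ha1 (by norm_num : (0 : ℝ) < 9)
      linarith
    have hc0 : 0 < c := by linarith
    have hexp : c ^ 2 / 2 ≤ rexp c - 1 := by
      linarith [Real.quadratic_le_exp_of_nonneg hc0.le]
    have hden : 0 < rexp c - 1 := by
      have : 0 < c ^ 2 / 2 := by positivity
      linarith
    set u : ℝ := 2 / (rexp c - 1) with hu
    have hu0 : 0 ≤ u := div_nonneg zero_le_two hden.le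
    have huc : u ≤ 4 / c ^ 2 := by
      rw [hu, div_le_div_iff₀ hden (by positivity)]
      linarith
    have h81 : (81 : ℝ) ≤ c ^ 2 := by nlinarith
    have hu1 : u ≤ 4 / 81 :=
      huc.trans (div_le_div_of_nonneg_left (by norm_num) (by norm_num) h81)
    have hθu : circleHeatTrace L t ≤ 1 + u := circleHeatTrace_le_one_add hL ht
    have hcube : circleHeatTrace L t ^ 3 ≤ (1 + u) ^ 3 := pow_le_pow_left₀ hθ0 hθu 3
    have hπ4' : (81 : ℝ) ≤ π ^ 4 := by nlinarith
    calc circleHeatTrace L t ^ 3 - 1 ≤ (1 + u) ^ 3 - 1 := by linarith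
      _ ≤ 4 * u := cube_one_add_sub_one_le hu0 hu1
      _ ≤ 4 * (4 / c ^ 2) := by linarith
      _ = 16 * a ^ 2 / π ^ 4 := by rw [hca]; field_simp; norm_num
      _ ≤ a ^ 2 := by
          rw [div_le_iff₀ (by positivity)]
          nlinarith [mul_le_mul_of_nonneg_left hπ4' (sq_nonneg a)]
      _ ≤ a * Real.sqrt a := sq_le_mul_sqrt ha0.le ha1.le
      _ ≤ 8 * (a * Real.sqrt a) := by linarith

/-- `0 ≤ θ_L(t)³ - 1`. [folklore] -/
theorem circleHeatTrace_cube_sub_one_nonneg {L t : ℝ} (hL : 0 < L) (ht : 0 < t) :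
    0 ≤ circleHeatTrace L t ^ 3 - 1 :=
  sub_nonneg.mpr (one_le_pow₀ (one_le_circleHeatTrace hL ht))

/-- The dominant in density form: `(θ_L(t)³ - 1)/L³ ≤ 1/(t√t)`. [folklore] -/
theorem circleHeatTrace_cube_sub_one_div_le {L t : ℝ} (hL : 0 < L) (ht : 0 < t) :
    (circleHeatTrace L t ^ 3 - 1) / L ^ 3 ≤ 1 / (t * Real.sqrt t) := by
  rw [div_le_iff₀ (by positivity), one_div_mul_eq_div]
  exact circleHeatTrace_cube_sub_one_le hL ht

end Literature.Analysis.SpecialFunctions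

end
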